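import Mathlib
import Literature.Analysis.FluidPDE.LeiZhang2017AxisymmetricCriteria
import Summits.NavierStokesRegularity.OSWSelfSimilar.TypeIIInnerLimitMasterDatum
import Summits.NavierStokesRegularity.NavierStokesRegularity.Theses.CertifiedBlowup
import HarnessLib
/-!
# The Z1 inner object of a witness of the crux `CertifiedBlowupAxisymBlowup` (stmt-NavierStokesRegularity-0727), and
# the crux-level dichotomy «velocity-dominated core OR (AX-L) fails» (zone Z1 TEMPLATE §T1.4-I; kernel, unconditional)

HONEST FRAMING (cell ns-blowup GROUP B «PROFILE SEARCH», zone Z1; D-0035/D-0074): part XXXVI of the Z1 dictionary. With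
part XXXV the master theorem runs on datum-level hypotheses; the last numerical hypothesis `|Γ(0, ·)| ≤ Mₛ` is itself a
consequence of rapid decay (`HasRapidSpatialDecay.abs_swirl_le`, Lei–Zhang 2017 bookkeeping in the tree). Hence the
hypotheses of the Z1 census sentence are EXACTLY the witness class of the tree's crux
`Summit.NavierStokesRegularity.NavierStokesRegularity.Theses.CertifiedBlowup.CertifiedBlowupAxisymBlowup`
(`∃ ν > 0, T > 0, u, p: IsMaximalSmoothSolution ν 0 u p T ∧ IsLerayHopfOn T ν 0 (u 0) u ∧ HasRapidSpatialDecay (u 0) ∧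
IsAxisymmetric (u 0)`):

* `innerObject_master_of_axisymBlowupWitness` — for EVERY witness `(ν, T, u, p)` of the crux: part XXXV's conclusion with
  some `Mₛ` bounding the datum's swirl (gauge N-a zoom, `tₖ → T`, near-max points, centres accumulating on the singular
  set on the axis, ONE subsequence, KNSS blow-up limit `W` with the Oseen identity, zoomed vorticity, (α)/(β) with every
  rider);
* `innerObject_typeAlpha_of_axisymBlowupWitness_under_axisymmetricLiouville` — IF (AX-L) holds, every witness is
  VELOCITY-DOMINATED at the core scale: the inner object is a constant unit vector field `c` with `c₁ = 0` and the zoomed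
  vorticity tends to `0` everywhere (type (α));
* `certifiedBlowupAxisymBlowup_innerObject_dichotomy` — AT THE LEVEL OF THE CRUX DECL: `CertifiedBlowupAxisymBlowup →
  ¬ AxisymmetricLiouvilleBoundedSwirl ∨ (a witness whose inner object is of type (α))`.

**Nothing here asserts that a singular solution exists or that (AX-L) holds or fails** — every statement is an
implication from the crux / about a hypothetical witness. «violates: n/a — dictionary; census sentence on the crux class
by decl»; bears_on LADDER-NS N5/Z1 → N1 linear core / N0⁻. Author: ns-blowup-profile-eng-1 g9, 2026-08-27.
-/

open Real Filter Topology Set MeasureTheory Function Bornology Metric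
open scoped ENNReal NNReal
open Literature.Analysis.FluidPDE

namespace Summit.NavierStokesRegularity.OSWSelfSimilar
namespace TypeIIModulationDictionary

section AxisymBlowupWitness

variable {T ν : ℝ} {u : ℝ → EuclideanSpace ℝ (Fin 3) → EuclideanSpace ℝ (Fin 3)}
  {p : ℝ → EuclideanSpace ℝ (Fin 3) → ℝ}

/-- **THE Z1 INNER OBJECT OF A WITNESS OF `CertifiedBlowupAxisymBlowup` (unconditional; any ν > 0).** Hypotheses = the
witness class of the crux verbatim (`IsMaximalSmoothSolution ν 0 u p T`, `0 < ν`, `0 < T`, `IsLerayHopfOn T ν 0 (u 0) u`,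
`HasRapidSpatialDecay (u 0)`, `IsAxisymmetric (u 0)`); conclusion = part XXXV's master theorem with a swirl bound `Mₛ`
of the datum produced from rapid decay. [new here — dictionary; unconditional] -/
theorem innerObject_master_of_axisymBlowupWitness (hν : 0 < ν) (hT : 0 < T)
    (hmax : IsMaximalSmoothSolution ν 0 u p T) (hLH : IsLerayHopfOn T ν 0 (u 0) u)
    (hdec : HasRapidSpatialDecay (u 0)) (haxi : IsAxisymmetric (u 0)) :
    ∃ (Mₛ : ℝ) (tn lamn : ℕ → ℝ) (cn xn : ℕ → EuclideanSpace ℝ (Fin 3)) (φ : ℕ → ℕ)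
      (W : ℝ → EuclideanSpace ℝ (Fin 3) → EuclideanSpace ℝ (Fin 3)),
      (∀ x, |swirl (u 0) x| ≤ Mₛ) ∧
      (∀ k, T / 2 ≤ tn k ∧ tn k < T) ∧ Tendsto tn atTop (𝓝 T) ∧ (∀ k, 0 < lamn k) ∧ Tendsto lamn atTop (𝓝 0) ∧
      (∀ k, ∀ t ∈ Icc 0 (tn k), ∀ x, lamn k / ν * ‖u t x‖ ≤ 1) ∧
      Tendsto (fun k => lamn k / ν * ‖u (tn k) (xn k)‖) atTop (𝓝 1) ∧
      (∃ D : ℝ, ∀ k, ‖xn k - cn k‖ ≤ D * lamn k) ∧ (∃ R : ℝ, ∀ k, ‖cn k‖ ≤ R) ∧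
      (∀ x₀ : EuclideanSpace ℝ (Fin 3), MapClusterPt x₀ atTop cn → ¬ IsBoundedNearTop u T x₀ ∧ cylRadius x₀ = 0) ∧
      (∃ x₀ : EuclideanSpace ℝ (Fin 3), MapClusterPt x₀ atTop cn) ∧
      Tendsto (fun k => cylRadius (cn k)) atTop (𝓝 0) ∧
      StrictMono φ ∧ IsKNSSBlowupLimit W ∧
      (∀ s < 0, TendstoLocallyUniformly
        (fun k => ((lamn (φ k) / ν) • stPull (lamn (φ k) ^ 2 / ν) (lamn (φ k)) (tn (φ k)) (cn (φ k)) u) s)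
          (W s) atTop) ∧
      (∀ s t : ℝ, s < t → t < 0 → ∀ x,
        W t x = Literature.Analysis.UnboundedOperators.heatExtension (W s) (t - s) x - oseenDuhamel 1 s W W t x) ∧
      (∀ s < 0, ∀ y : EuclideanSpace ℝ (Fin 3), Tendsto (fun j => (lamn (φ j) ^ 2 / ν) •
        curl (u (tn (φ j) + lamn (φ j) ^ 2 / ν * s)) (cn (φ j) + lamn (φ j) • y)) atTop (𝓝 (curl (W s) y))) ∧
      (((∃ c : EuclideanSpace ℝ (Fin 3), ‖c‖ = 1 ∧ c 1 = 0 ∧ ∀ s < 0, ∀ y : EuclideanSpace ℝ (Fin 3), W s y = c) ∧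
          ∀ s < 0, ∀ y : EuclideanSpace ℝ (Fin 3), Tendsto (fun j => (lamn (φ j) ^ 2 / ν) •
            curl (u (tn (φ j) + lamn (φ j) ^ 2 / ν * s)) (cn (φ j) + lamn (φ j) • y)) atTop (𝓝 0)) ∨
        ((∀ k, cn k 0 = 0 ∧ cn k 1 = 0) ∧
          ¬ Summit.NavierStokesRegularity.NavierStokesRegularity.AxisymmetricLiouvilleBoundedSwirl ∧
          (∀ s < 0, IsAxisymmetric (W s)) ∧ (∀ s < 0, ∀ y : EuclideanSpace ℝ (Fin 3), |swirl (W s) y| ≤ Mₛ / ν) ∧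
          (∃ s < 0, ∃ x : EuclideanSpace ℝ (Fin 3), W s x ≠ W s 0) ∧
          (∃ s < 0, ∃ y : EuclideanSpace ℝ (Fin 3), curl (W s) y ≠ 0) ∧
          (∃ s < 0, ∃ y : EuclideanSpace ℝ (Fin 3), swirl (W s) y ≠ 0 ∧
            Tendsto (fun k => ν⁻¹ * swirl (u (tn (φ k) + lamn (φ k) ^ 2 / ν * s)) (cn (φ k) + lamn (φ k) • y)) atTop
              (𝓝 (swirl (W s) y))) ∧
          (∀ C : ℝ, ∃ s < 0, ∃ x : EuclideanSpace ℝ (Fin 3), C < cylRadius x * ‖poloidalPart (W s) x‖) ∧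
          (∀ c C : ℝ, ∃ s < 0, ∃ x : EuclideanSpace ℝ (Fin 3), C < cylRadius x * ‖poloidalPart (W s) x - c • eZ‖) ∧
          (∀ q : ℝ≥0∞, 1 ≤ q → q < ⊤ → ∀ K : ℝ≥0, ∃ s < 0, (K : ℝ≥0∞) < eLpNorm (swirl (W s)) q volume) ∧
          (∃ ε : ℝ, 0 < ε ∧ ∀ R : ℝ, ∃ s < 0, ∃ x : EuclideanSpace ℝ (Fin 3),
            R ≤ cylRadius x ∧ ε < |swirl (W s) x|) ∧
          ∃ ε₀ ∈ Set.Ioo (0 : ℝ) 1, ∀ L R₀ : ℝ, ∃ s < 0, ∃ x : EuclideanSpace ℝ (Fin 3),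
            R₀ ≤ cylRadius x ∧ ε₀ * L ^ 2 / cylRadius x < |swirl (W s) x ^ 2 - L ^ 2|)) := by
  obtain ⟨Mₛ, hMₛ⟩ := hdec.abs_swirl_le
  obtain ⟨tn, lamn, cn, xn, φ, W, h⟩ := innerObject_master_of_datum hν hT hmax hLH hdec haxi hMₛ
  exact ⟨Mₛ, tn, lamn, cn, xn, φ, W, hMₛ, h⟩

/-- **IF (AX-L) HOLDS, EVERY WITNESS OF `CertifiedBlowupAxisymBlowup` IS VELOCITY-DOMINATED AT THE CORE SCALE (type (α)).**
Under `AxisymmetricLiouvilleBoundedSwirl`, for every witness `(ν, T, u, p)`: gauge N-a zoom data with `tₖ → T`, centres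
accumulating on the axis (`cylRadius cₖ → 0`, every cluster point a singular point on the axis), and a subsequence along
which the zoom converges to a CONSTANT unit field `c` (`‖c‖ = 1`, `c₁ = 0`) while the zoomed vorticity
`(λₖ²/ν) ω(tₖ + (λₖ²/ν)s, cₖ + λₖy) → 0` for all `s < 0`, `y`. [new here — dictionary; conditional on (AX-L)] -/
theorem innerObject_typeAlpha_of_axisymBlowupWitness_under_axisymmetricLiouville
    (hAXL : Summit.NavierStokesRegularity.NavierStokesRegularity.AxisymmetricLiouvilleBoundedSwirl)
    (hν : 0 < ν) (hT : 0 < T) (hmax : IsMaximalSmoothSolution ν 0 u p T) (hLH : IsLerayHopfOn T ν 0 (u 0) u)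
    (hdec : HasRapidSpatialDecay (u 0)) (haxi : IsAxisymmetric (u 0)) :
    ∃ (tn lamn : ℕ → ℝ) (cn : ℕ → EuclideanSpace ℝ (Fin 3)) (φ : ℕ → ℕ)
      (W : ℝ → EuclideanSpace ℝ (Fin 3) → EuclideanSpace ℝ (Fin 3)) (c : EuclideanSpace ℝ (Fin 3)),
      (∀ k, T / 2 ≤ tn k ∧ tn k < T) ∧ Tendsto tn atTop (𝓝 T) ∧ (∀ k, 0 < lamn k) ∧ Tendsto lamn atTop (𝓝 0) ∧
      (∀ k, ∀ t ∈ Icc 0 (tn k), ∀ x, lamn k / ν * ‖u t x‖ ≤ 1) ∧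
      (∀ x₀ : EuclideanSpace ℝ (Fin 3), MapClusterPt x₀ atTop cn → ¬ IsBoundedNearTop u T x₀ ∧ cylRadius x₀ = 0) ∧
      Tendsto (fun k => cylRadius (cn k)) atTop (𝓝 0) ∧
      StrictMono φ ∧ IsKNSSBlowupLimit W ∧
      (∀ s < 0, TendstoLocallyUniformly
        (fun k => ((lamn (φ k) / ν) • stPull (lamn (φ k) ^ 2 / ν) (lamn (φ k)) (tn (φ k)) (cn (φ k)) u) s)
          (W s) atTop) ∧
      ‖c‖ = 1 ∧ c 1 = 0 ∧ (∀ s < 0, ∀ y : EuclideanSpace ℝ (Fin 3), W s y = c) ∧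
      ∀ s < 0, ∀ y : EuclideanSpace ℝ (Fin 3), Tendsto (fun j => (lamn (φ j) ^ 2 / ν) •
        curl (u (tn (φ j) + lamn (φ j) ^ 2 / ν * s)) (cn (φ j) + lamn (φ j) • y)) atTop (𝓝 0) := by
  obtain ⟨Mₛ, tn, lamn, cn, xn, φ, W, -, htn, htT, hlam, hlam0, hgauge, -, -, -, hclus, -, hcyl, hφ, hW, hconv, -, -,
    halt⟩ := innerObject_master_of_axisymBlowupWitness hν hT hmax hLH hdec haxi
  rcases halt with ⟨⟨c, hc1, hc0, hWc⟩, hzero⟩ | ⟨-, hnot, -⟩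
  · exact ⟨tn, lamn, cn, φ, W, c, htn, htT, hlam, hlam0, hgauge, hclus, hcyl, hφ, hW, hconv, hc1, hc0, hWc, hzero⟩
  · exact absurd hAXL hnot

/-- **THE CRUX-LEVEL DICHOTOMY, BY DECL.** `CertifiedBlowupAxisymBlowup` (stmt-NavierStokesRegularity-0727) implies: EITHER
the axisymmetric bounded-swirl Liouville conjecture (AX-L) FAILS, OR some witness `(ν, T, u, p)` of the crux has a
velocity-dominated inner object — gauge N-a zoom along a subsequence converging to a constant unit field `c` (`‖c‖ = 1`,
`c₁ = 0`) with zoomed vorticity `→ 0`, `tₖ → T`, centres accumulating on the axis. [new here — dictionary; unconditional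
implication from the crux] -/
theorem certifiedBlowupAxisymBlowup_innerObject_dichotomy
    (hX : Summit.NavierStokesRegularity.NavierStokesRegularity.Theses.CertifiedBlowup.CertifiedBlowupAxisymBlowup) :
    ¬ Summit.NavierStokesRegularity.NavierStokesRegularity.AxisymmetricLiouvilleBoundedSwirl ∨
      ∃ (ν T : ℝ) (u : ℝ → EuclideanSpace ℝ (Fin 3) → EuclideanSpace ℝ (Fin 3)) (p : ℝ → EuclideanSpace ℝ (Fin 3) → ℝ)
        (tn lamn : ℕ → ℝ) (cn : ℕ → EuclideanSpace ℝ (Fin 3)) (φ : ℕ → ℕ)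
        (W : ℝ → EuclideanSpace ℝ (Fin 3) → EuclideanSpace ℝ (Fin 3)) (c : EuclideanSpace ℝ (Fin 3)),
        0 < ν ∧ 0 < T ∧ IsMaximalSmoothSolution ν 0 u p T ∧ IsLerayHopfOn T ν 0 (u 0) u ∧
        HasRapidSpatialDecay (u 0) ∧ IsAxisymmetric (u 0) ∧
        (∀ k, T / 2 ≤ tn k ∧ tn k < T) ∧ Tendsto tn atTop (𝓝 T) ∧ (∀ k, 0 < lamn k) ∧ Tendsto lamn atTop (𝓝 0) ∧
        (∀ k, ∀ t ∈ Icc 0 (tn k), ∀ x, lamn k / ν * ‖u t x‖ ≤ 1) ∧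
        (∀ x₀ : EuclideanSpace ℝ (Fin 3), MapClusterPt x₀ atTop cn → ¬ IsBoundedNearTop u T x₀ ∧ cylRadius x₀ = 0) ∧
        Tendsto (fun k => cylRadius (cn k)) atTop (𝓝 0) ∧
        StrictMono φ ∧ IsKNSSBlowupLimit W ∧
        (∀ s < 0, TendstoLocallyUniformly
          (fun k => ((lamn (φ k) / ν) • stPull (lamn (φ k) ^ 2 / ν) (lamn (φ k)) (tn (φ k)) (cn (φ k)) u) s)
            (W s) atTop) ∧
        ‖c‖ = 1 ∧ c 1 = 0 ∧ (∀ s < 0, ∀ y : EuclideanSpace ℝ (Fin 3), W s y = c) ∧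
        ∀ s < 0, ∀ y : EuclideanSpace ℝ (Fin 3), Tendsto (fun j => (lamn (φ j) ^ 2 / ν) •
          curl (u (tn (φ j) + lamn (φ j) ^ 2 / ν * s)) (cn (φ j) + lamn (φ j) • y)) atTop (𝓝 0) := by
  by_cases hAXL : Summit.NavierStokesRegularity.NavierStokesRegularity.AxisymmetricLiouvilleBoundedSwirl
  · obtain ⟨ν, hν, T, hT, u, p, hmax, hLH, hdec, haxi⟩ := hX
    obtain ⟨tn, lamn, cn, φ, W, c, h⟩ :=
      innerObject_typeAlpha_of_axisymBlowupWitness_under_axisymmetricLiouville hAXL hν hT hmax hLH hdec haxi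
    exact Or.inr ⟨ν, T, u, p, tn, lamn, cn, φ, W, c, hν, hT, hmax, hLH, hdec, haxi, h⟩
  · exact Or.inl hAXL

end AxisymBlowupWitness

end TypeIIModulationDictionary
end Summit.NavierStokesRegularity.OSWSelfSimilar
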